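import Mathlib
import Literature.AlgebraicGeometry.Resolution.CobordantGame
import Literature.AlgebraicGeometry.Resolution.CobordantChartCoefficients
import Literature.AlgebraicGeometry.Resolution.CobordantChartOneMove
import Summits.ResolutionOfSingularities.ResolutionOfSingularities.Theorems.WeightedInvariantLocalWeightedDropOffVertexConeWin

/-!
# `WeightedInvariant.LocalWeightedDrop`: one-move wins from the INITIAL FORM — semi-quasihomogeneous germs

Crux item stmt-ResolutionOfSingularities-8899 `LocalWeightedDrop` (route `ResolutionOfSingularities/WeightedInvariant`), skeleton v30,
residual stubs W4|₄ `stub_wildWideApexFourStartsWon` / W4|₅₊ `stub_wildWideApexFiveUpStartsWon`.  [OURS · L1 W4.3, chain w43, stub worker 4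
(gen 4): the perturbation form of the tree's one-move win `GradedGame.won_of_isWeightedHomogeneous_offVertex` (which asks the germ to BE a
weighted-homogeneous polynomial); NOT a statement of any manuscript.]

`won_of_initialForm_offVertex`: let `f = P + R` with `P` a non-zero `w`-weighted-homogeneous polynomial of weight `a` whose affine cone is
smooth off the vertex directions (`P(c) = 0 ∧ ∇P(c) = 0 ⇒ c = 0` for the points `c` supported on the positive-weight slots) and `R` any
power series of `w`-order `> a`.  Then the move `(X, w)` has NO singular successor, so `f` is won (one move): in the singular-successor
criterion `CobordantChart.successor_singular_iff` the weight-`a` value `P_a(c)` and gradient `∂P_a(c)` of `f` are those of `P`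
(`initEval_add_of_lt_weightedOrder`, `initEvalD_add_of_lt_weightedOrder`) — the higher-order tail never matters, wild or tame.

W4 instance (`won_dp_of_initialForm_offVertex`, every characteristic, every field, every dimension): the double point
`y² + F + R` with `F` a homogeneous form of ODD degree `r` in the old variables whose projective hypersurface has no singular `k`-point
(`F(c) = 0 ∧ ∇F(c) = 0 ⇒ c = 0`) and `R` of `(2,…,2,r)`-weighted order `> 2r` is won by ONE weighted blow-up with weights `2` on the old
variables and `r` on `y` — e.g. `y² + x₀³ + x₁³ + x₂³ + …` in characteristic `2` (wild: `2 ∣ 2`), a NON-terminal member of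
W4|₄ ∩ {d = 2}.  (In characteristic `2` the `y`-derivative vanishes identically; Euler's identity for odd `r` supplies `F(c) = 0`.)
-/

set_option linter.dupNamespace false -- mandated namespace of this single-conjunct summit
set_option autoImplicit false

namespace Summit.ResolutionOfSingularities.ResolutionOfSingularities.Theorems

namespace InitialFormConeWin

open Literature.AlgebraicGeometry.Resolution
open Literature.AlgebraicGeometry.Resolution.CobordantChart

variable {k : Type} [Field k] {n : ℕ}

/-- Below the `w`-order of the tail, `P_b(c)` only sees the head: `(F + R)_b(c) = F_b(c)`. -/
theorem initEval_add_of_lt_weightedOrder (w : Fin n → ℕ) (c : Fin n → k) (F R : MvPowerSeries (Fin n) k) {b : ℕ}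
    (hR : (b : ℕ∞) < R.weightedOrder w) : initEval w c b (F + R) = initEval w c b F := by
  classical
  unfold initEval
  refine finsum_congr fun d => ?_
  split_ifs with hd
  · rw [map_add, MvPowerSeries.coeff_eq_zero_of_lt_weightedOrder w (f := R) (by rw [hd]; exact hR), add_zero]
  · rfl

/-- Below the `w`-order of the tail, `∂ᵢP_b(c)` only sees the head. -/
theorem initEvalD_add_of_lt_weightedOrder (w : Fin n → ℕ) (c : Fin n → k) (F R : MvPowerSeries (Fin n) k) {b : ℕ}
    (hR : (b : ℕ∞) < R.weightedOrder w) (i : Fin n) : initEvalD w c b (F + R) i = initEvalD w c b F i := by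
  classical
  unfold initEvalD
  refine finsum_congr fun d => ?_
  split_ifs with hd
  · rw [map_add, MvPowerSeries.coeff_eq_zero_of_lt_weightedOrder w (f := R) (by rw [hd]; exact hR), add_zero]
  · rfl

/-- The `w`-order of `P + R` is the weight `a` of the non-zero `w`-homogeneous head `P` when `R` has `w`-order `> a`. -/
theorem weightedOrder_coe_add_of_lt (w : Fin n → ℕ) {P : MvPolynomial (Fin n) k} {a : ℕ} (hP : P.IsWeightedHomogeneous w a)
    (hP0 : P ≠ 0) (R : MvPowerSeries (Fin n) k) (hR : (a : ℕ∞) < R.weightedOrder w) :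
    ((P : MvPowerSeries (Fin n) k) + R).weightedOrder w = a := by
  have h1 := weightedOrder_coe_of_isWeightedHomogeneous w hP hP0
  have h2 : (P : MvPowerSeries (Fin n) k).weightedOrder w ≠ R.weightedOrder w := by rw [h1]; exact hR.ne
  rw [MvPowerSeries.weightedOrder_add_of_weightedOrder_ne w h2, h1, min_eq_left hR.le]

/-- ONE-MOVE WIN FROM THE INITIAL FORM: if the `w`-initial form `P` of `f = P + R` (`R` of `w`-order `> a = deg_w P`) has affine cone
smooth off the vertex directions, then at every exceptional point `c ≠ 0` (supported on the positive-weight slots) the `s`-saturated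
transform of `f` under the chart of weights `w` is NON-SINGULAR. -/
theorem successor_nonsingular_of_initialForm_offVertex (w : Fin n → ℕ) {P : MvPolynomial (Fin n) k}
    {a : ℕ} (hP : P.IsWeightedHomogeneous w a) (hP0 : P ≠ 0)
    (hcone : ∀ c : Fin n → k, (∀ i, w i = 0 → c i = 0) → MvPolynomial.eval c P = 0 →
      (∀ i, MvPolynomial.eval c (MvPolynomial.pderiv i P) = 0) → c = 0)
    (R : MvPowerSeries (Fin n) k) (hR : (a : ℕ∞) < R.weightedOrder w)
    (c : Fin n → k) (hc : ∀ i, w i = 0 → c i = 0) (hcne : c ≠ 0)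
    {e : ℕ} {g : MvPowerSeries (Fin (n + 1)) k}
    (hfac : MvPowerSeries.subst (chart w c) ((P : MvPowerSeries (Fin n) k) + R) = MvPowerSeries.X 0 ^ e * g)
    (hg : ¬ MvPowerSeries.X 0 ∣ g) :
    ¬ (MvPowerSeries.constantCoeff g = 0 ∧ ∀ j, MvPowerSeries.coeff (Finsupp.single j 1) g = 0) := by
  classical
  have hwo := weightedOrder_coe_add_of_lt w hP hP0 R hR
  have hf0 : ((P : MvPowerSeries (Fin n) k) + R) ≠ 0 := by
    intro h
    rw [h, MvPowerSeries.weightedOrder_zero] at hwo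
    exact ENat.top_ne_coe a hwo
  have he : e = a := by
    have h1 := eq_weightedOrder_of_factor w c hc hf0 hfac hg
    rw [hwo] at h1
    exact_mod_cast h1
  subst he
  intro hsing
  obtain ⟨hPa, hD, -⟩ := (successor_singular_iff w c hc _ hfac).mp hsing
  rw [initEval_add_of_lt_weightedOrder w c _ R hR, initEval_coe, hP.weightedHomogeneousComponent_same] at hPa
  have hD' : ∀ i, MvPolynomial.eval c (MvPolynomial.pderiv i P) = 0 := by
    intro i
    have := hD i
    rwa [initEvalD_add_of_lt_weightedOrder w c _ R hR, initEvalD_coe, hP.weightedHomogeneousComponent_same] at this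
  exact hcne (hcone c hc hPa hD')

/-- **SEMI-QUASIHOMOGENEOUS GERMS ARE WON IN ONE MOVE.**  `f = P + R`, `P ≠ 0` `w`-weighted-homogeneous of weight `a` with affine cone
smooth off the vertex directions, `R` of `w`-order `> a` ⇒ `CobordantGame.Won k n f` — the move `(X, w)` has no singular successor;
the tail `R` and the wildness of the weights are irrelevant. [OURS · L1 W4.3] -/
theorem won_of_initialForm_offVertex (w : Fin n → ℕ) (hw : ∃ i, 0 < w i) {P : MvPolynomial (Fin n) k}
    {a : ℕ} (hP : P.IsWeightedHomogeneous w a) (hP0 : P ≠ 0)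
    (hcone : ∀ c : Fin n → k, (∀ i, w i = 0 → c i = 0) → MvPolynomial.eval c P = 0 →
      (∀ i, MvPolynomial.eval c (MvPolynomial.pderiv i P) = 0) → c = 0)
    (R : MvPowerSeries (Fin n) k) (hR : (a : ℕ∞) < R.weightedOrder w) :
    CobordantGame.Won k n ((P : MvPowerSeries (Fin n) k) + R) := by
  refine CobordantGame.Won.move MvPowerSeries.X w (GradedGame.isMove_X w hw) fun g hg => ?_
  obtain ⟨c, e, hoff, hfac, hndvd, hsing⟩ := hg
  have hself : MvPowerSeries.subst (MvPowerSeries.X : Fin n → MvPowerSeries (Fin n) k) ((P : MvPowerSeries (Fin n) k) + R) =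
      (P : MvPowerSeries (Fin n) k) + R := by
    rw [MvPowerSeries.subst_self]; rfl
  unfold CobordantGame.cruxChart at hfac
  rw [cruxChart_eq_chart, hself] at hfac
  refine absurd hsing (successor_nonsingular_of_initialForm_offVertex w hP hP0 hcone R hR _ (fun i hi => ?_) ?_ hfac hndvd)
  · have : ¬ 0 < w i := by omega
    simp [this]
  · obtain ⟨i, hi, hci⟩ := hoff
    intro h
    have := congrFun h i
    simp [hi] at this
    exact hci this


/-! ### The W4 instance: double points `y² + F + R` with a non-degenerate odd form `F` -/

/-- Weights `(2, …, 2, r)`: the old slots have weight `2`. -/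
theorem insertNth_two_castSucc {m : ℕ} (r : ℕ) (l : Fin (m + 1)) :
    Fin.insertNth (α := fun _ => ℕ) (Fin.last (m + 1)) r (fun _ => 2) (Fin.castSucc l) = 2 := by
  rw [← Fin.succAbove_last, Fin.insertNth_apply_succAbove]

/-- The renamed form `F♯` is `(2,…,2,r)`-homogeneous of weight `2r` when `F` is homogeneous of degree `r`. -/
theorem isWeightedHomogeneous_rename_of_isHomogeneous {m : ℕ} (r : ℕ) {F : MvPolynomial (Fin (m + 1)) k}
    (hF : F.IsHomogeneous r) :
    (MvPolynomial.rename (Fin.succAboveEmb (Fin.last (m + 1))) F).IsWeightedHomogeneous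
      (Fin.insertNth (α := fun _ => ℕ) (Fin.last (m + 1)) r (fun _ => 2)) (2 * r) := by
  classical
  intro d hd
  obtain ⟨u, rfl, hu⟩ := MvPolynomial.coeff_rename_ne_zero _ F d hd
  have hdeg := hF hu
  rw [Finsupp.weight_apply, Finsupp.sum_mapDomain_index_inj (Fin.succAboveEmb (Fin.last (m + 1))).injective]
  rw [Finsupp.weight_apply] at hdeg
  simp only [Fin.coe_succAboveEmb, Fin.succAbove_last, insertNth_two_castSucc, smul_eq_mul, Pi.one_apply, mul_one] at hdeg ⊢
  rw [← hdeg, Finsupp.sum, Finsupp.sum, Finset.mul_sum]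
  exact Finset.sum_congr rfl fun l _ => by ring

/-- **THE W4 INSTANCE** (every characteristic, every field, every dimension): `y² + F(x) + R` with `F` a homogeneous form of ODD degree
`r` in the old variables `x₀, …, x_m` such that `F(c) = 0 ∧ ∇F(c) = 0 ⇒ c = 0`, and `R` of `(2,…,2,r)`-weighted order `> 2r`, is won by
ONE weighted blow-up (weights `2` on the old variables, `r` on `y`).  In characteristic `2` the weights on the old slots are wild and
`∂/∂y ≡ 0` on the head; Euler's identity for odd `r` supplies `F(c) = 0`.  E.g. `y² + x₀³ + x₁³ + x₂³ + R` in characteristic `2`: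
a NON-terminal member of W4|₄ ∩ {d = 2} won in kernel. [OURS · L1 W4.3 · engine residual W4] -/
theorem won_dp_of_initialForm_offVertex (k : Type) [Field k] {m : ℕ} (r : ℕ) (hr : Odd r) (F : MvPolynomial (Fin (m + 1)) k)
    (hF : F.IsHomogeneous r)
    (hcone : ∀ c : Fin (m + 1) → k, MvPolynomial.eval c F = 0 → (∀ i, MvPolynomial.eval c (MvPolynomial.pderiv i F) = 0) → c = 0)
    (R : MvPowerSeries (Fin (m + 1 + 1)) k)
    (hR : ((2 * r : ℕ) : ℕ∞) < R.weightedOrder (Fin.insertNth (α := fun _ => ℕ) (Fin.last (m + 1)) r (fun _ => 2))) :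
    CobordantGame.Won k (m + 1 + 1) (MvPowerSeries.X (Fin.last (m + 1)) ^ 2 +
      MvPowerSeries.rename (Fin.succAboveEmb (Fin.last (m + 1))) (F : MvPowerSeries (Fin (m + 1)) k) + R) := by
  classical
  set w : Fin (m + 1 + 1) → ℕ := Fin.insertNth (α := fun _ => ℕ) (Fin.last (m + 1)) r (fun _ => 2) with hw
  set P : MvPolynomial (Fin (m + 1 + 1)) k := MvPolynomial.X (Fin.last (m + 1)) ^ 2 +
    MvPolynomial.rename (Fin.succAboveEmb (Fin.last (m + 1))) F with hP
  have hr0 : 0 < r := hr.pos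
  have hwlast : w (Fin.last (m + 1)) = r := by rw [hw, Fin.insertNth_apply_same]
  have hcoe : (MvPowerSeries.X (Fin.last (m + 1)) ^ 2 +
      MvPowerSeries.rename (Fin.succAboveEmb (Fin.last (m + 1))) (F : MvPowerSeries (Fin (m + 1)) k) + R) =
      (P : MvPowerSeries (Fin (m + 1 + 1)) k) + R := by
    rw [hP, MvPolynomial.coe_add, MvPolynomial.coe_pow, MvPolynomial.coe_X, MvPowerSeries.rename_coe]
  rw [hcoe]
  -- weighted homogeneity and non-vanishing of the head
  have hPh : P.IsWeightedHomogeneous w (2 * r) := by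
    refine MvPolynomial.IsWeightedHomogeneous.add ?_ (isWeightedHomogeneous_rename_of_isHomogeneous r hF)
    have h := (MvPolynomial.isWeightedHomogeneous_X k w (Fin.last (m + 1))).pow 2
    rwa [hwlast, smul_eq_mul] at h
  have hP0 : P ≠ 0 := by
    intro h
    have hc := congrArg (MvPolynomial.coeff (Finsupp.single (Fin.last (m + 1)) 2)) h
    rw [hP, MvPolynomial.coeff_add, MvPolynomial.coeff_X_pow, if_pos rfl, MvPolynomial.coeff_zero,
      MvPolynomial.coeff_rename_eq_zero] at hc
    · simp at hc
    · intro u hu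
      have := congrArg (fun e => e (Fin.last (m + 1))) hu
      simp only [Finsupp.single_eq_same] at this
      rw [Finsupp.mapDomain_notin_range] at this
      · exact absurd this (by norm_num)
      · rintro ⟨l, hl⟩
        exact absurd hl (Fin.succAbove_ne _ _)
  -- the cone of the head is smooth off the vertex
  have hcone' : ∀ c : Fin (m + 1 + 1) → k, (∀ i, w i = 0 → c i = 0) → MvPolynomial.eval c P = 0 →
      (∀ i, MvPolynomial.eval c (MvPolynomial.pderiv i P) = 0) → c = 0 := by
    intro c _ hPc hDc
    set cx : Fin (m + 1) → k := fun l => c (Fin.castSucc l) with hcx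
    have hcomp : (c ∘ Fin.succAboveEmb (Fin.last (m + 1))) = cx := by
      funext l; simp [hcx, Fin.succAbove_last]
    have hevP : MvPolynomial.eval c P = c (Fin.last (m + 1)) ^ 2 + MvPolynomial.eval cx F := by
      rw [hP, map_add, map_pow, MvPolynomial.eval_X, MvPolynomial.eval_rename, hcomp]
    -- the partial derivatives of the head
    have hvars : Fin.last (m + 1) ∉ (MvPolynomial.rename (Fin.succAboveEmb (Fin.last (m + 1))) F).vars := fun hmem => by
      obtain ⟨l, -, hl⟩ := Finset.mem_image.mp (MvPolynomial.vars_rename _ _ hmem)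
      exact Fin.succAbove_ne _ _ hl
    have hdP : MvPolynomial.pderiv (Fin.last (m + 1)) P = 2 * MvPolynomial.X (Fin.last (m + 1)) := by
      rw [hP, map_add, MvPolynomial.pderiv_eq_zero_of_notMem_vars hvars, add_zero, sq, MvPolynomial.pderiv_mul,
        MvPolynomial.pderiv_X, Pi.single_eq_same]
      ring
    have hdPl : ∀ l : Fin (m + 1), MvPolynomial.pderiv (Fin.castSucc l) P =
        MvPolynomial.rename (Fin.succAboveEmb (Fin.last (m + 1))) (MvPolynomial.pderiv l F) := by
      intro l
      have he : (Fin.succAboveEmb (Fin.last (m + 1))) l = Fin.castSucc l := by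
        rw [Fin.coe_succAboveEmb, Fin.succAbove_last]
      rw [hP, map_add, sq, MvPolynomial.pderiv_mul, MvPolynomial.pderiv_X, Pi.single_eq_of_ne (Fin.castSucc_lt_last l).ne',
        zero_mul, mul_zero, add_zero, zero_add, ← he, MvPolynomial.pderiv_rename (Fin.succAboveEmb _).injective]
    -- the old-slot derivatives: `∂_l F (cx) = 0`
    have hDF : ∀ l, MvPolynomial.eval cx (MvPolynomial.pderiv l F) = 0 := by
      intro l
      have h := hDc (Fin.castSucc l)
      rw [hdPl, MvPolynomial.eval_rename, hcomp] at h
      exact h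
    -- `F(cx) = 0`: Euler (r odd) in characteristic `2`, the `y`-derivative otherwise
    have hFc : MvPolynomial.eval cx F = 0 := by
      by_cases h2 : (2 : k) = 0
      · have heuler := congrArg (MvPolynomial.eval cx) hF.sum_X_mul_pderiv
        rw [map_sum, Finset.sum_eq_zero (fun l _ => by rw [map_mul, hDF l, mul_zero]), map_nsmul, eq_comm,
          nsmul_eq_mul] at heuler
        obtain ⟨s, rfl⟩ := hr
        have hcast : ((2 * s + 1 : ℕ) : k) = 1 := by push_cast; rw [h2, zero_mul, zero_add]
        rwa [hcast, one_mul] at heuler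
      · have h := hDc (Fin.last (m + 1))
        rw [hdP, map_mul, map_ofNat, MvPolynomial.eval_X] at h
        have hcl : c (Fin.last (m + 1)) = 0 := (mul_eq_zero.mp h).resolve_left h2
        rw [hevP, hcl, zero_pow two_ne_zero, zero_add] at hPc
        exact hPc
    have hcx0 : cx = 0 := hcone cx hFc hDF
    have hcl : c (Fin.last (m + 1)) = 0 := by
      rw [hevP, hFc, add_zero] at hPc
      exact pow_eq_zero_iff two_ne_zero |>.mp hPc
    funext i
    rcases Fin.eq_castSucc_or_eq_last i with ⟨l, rfl⟩ | rfl
    · exact congrFun hcx0 l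
    · exact hcl
  exact won_of_initialForm_offVertex w ⟨Fin.last (m + 1), by rw [hwlast]; exact hr0⟩ hPh hP0 hcone' R hR

end InitialFormConeWin

end Summit.ResolutionOfSingularities.ResolutionOfSingularities.Theorems
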